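import Summits.ResolutionOfSingularities.ResolutionOfSingularities.Theorems.FrobeniusClosingPatchingRelPerfectDepthMixedDictionaryStep
import Literature.AlgebraicGeometry.Resolution.ExceptionalDivisorRegularGlobal
import HarnessLib

/-!
# Crux `PatchingRelPerfect` (stmt-ResolutionOfSingularities-16161), chain w52 — R4ˢ-general support:
# «RE-CARRIER» — handing the residual of a weight-deficient step to the new exceptional carrier

[OURS · L1 W5.2 · rung tool] res-L1-w52-plan-1 KERNEL NOTE v1.6 (STATUS 2026-08-27T05:26:19Z / CHAIN v1.6 §1): after a
step of weight `ν < ℓ` «the cosupport that ESCAPES the retract-open along the weight-`ν` exceptional carrier `F` is a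
problem of SMALLER DEPTH `ℓ − ν` on the regular threefold `F`». On the host side the monomial contact of D1^{ℓ,ν}
(`DepthOne.dictionaryStep_mixed`, p502493) after the step reads `σ^*N · 𝓘_G^{ℓ-ν} · 𝓘_{E'}^ℓ ≤ K'` with `G` the new
exceptional divisor; REGROUPING the monomial, this is contact of exponent `ℓ − ν` with respect to the carrier `G` and the
monomial `σ^*N · 𝓘_{E'}^ℓ`. This file proves, unbundled (the same binder shape as D1 / D_ℓ / D1^{ℓ,ν}, so that the
bundled invariants of the chain — `DepthTargets.DepthInvariant`, res-D-pv-052's `DepthInvariantMono` — repackage it in one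
line) and fact-free:
* `mul_pow_mul_pow_le_of_regroup` — the regrouping inequality `(N″ · 𝓘_E^ℓ) · 𝓘_G^w ≤ K` from `N · 𝓘_E^ℓ ≤ K`,
  `N = N″ · 𝓘_G^w`;
* `support_mul_ker_pow_over_closedPoint` — the regrouped monomial `N″ · 𝓘_E^ℓ` stays cosupported over the closed point
  when `N″` and `E` are;
* `exceptionalCarrier_package` — **the new exceptional divisor is a carrier**: for a blowing up `σ : X' ⟶ X` of a
  regular locally Noetherian `X` along `Ĉ` with `V(Ĉ)` regular and `Supp Ĉ` over the closed point of `Spec S`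
  (e.g. `Ĉ = C.map i` with `E` over the closed point): `G := V(Ĉ𝒪_{X'})` with `j = subschemeι` is a closed
  immersion with `ker j = Ĉ𝒪_{X'}` an EFFECTIVE CARTIER divisor, `G` is REGULAR (Liu Thm. 8.1.19 (b), the tree's
  `IsBlowup.isRegular_subscheme_comap`) and `G` lies over the closed point;
* `recarrier_of_dictionaryStep_mixed` — **after one D1^{ℓ,ν} step** with centre `Ĉ = C.map i` the conclusions
  `N' · 𝓘_{E'}^ℓ ≤ K'`, `N' = σ^*N · 𝓘_G^{ℓ-ν}` re-read as the depth-`(ℓ − ν)` monomial contact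
  `(σ^*N · 𝓘_{E'}^ℓ) · 𝓘_G^{ℓ-ν} ≤ K'` w.r.t. the carrier `G`, together with the carrier package of `G` and the
  support of the new monomial over the closed point — the host-side input of the «escaped depth-(ℓ−ν) sub-problem»
  (its E-side datum `K'|_G`, the weight-`ν` normal-cone initial ideal, is left abstract here).
Nothing here is a statement of the manuscript under review.

## References
* Q. Liu, *Algebraic Geometry and Arithmetic Curves* (2002), Thm. 8.1.19 (b). [Liu2002]
* U. Görtz, T. Wedhorn, *Algebraic Geometry I*, 2nd ed. (2020), Def. 13.90, Prop. 13.91 (1). [GortzWedhorn2020]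
* E. Bierstone, D. Grigoriev, P. Milman, J. Włodarczyk (2011), §3.2 Lemma 3.2.1. [BierstoneGrigorievMilmanWlodarczyk2011]
-/

-- `Summit.<Summit>.<Sub>.Theorems` with `Sub = Summit` (single-conjunct summit, D-0017)
set_option linter.dupNamespace false

noncomputable section

open CategoryTheory CategoryTheory.Limits AlgebraicGeometry TopologicalSpace
open Literature.AlgebraicGeometry.Resolution
open IsLocalRing

namespace Summit.ResolutionOfSingularities.ResolutionOfSingularities.Theorems

universe u

namespace DepthOne

/-! ## §1 Regrouping the contact monomial -/

/-- **Regrouping**: if `N · 𝓘_E^ℓ ≤ K` and `N = N″ · 𝓘_G^w` then `(N″ · 𝓘_E^ℓ) · 𝓘_G^w ≤ K` — the same contact read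
with `G` as the carrier (exponent `w`) and `N″ · 𝓘_E^ℓ` as the monomial. [folklore] -/
theorem mul_pow_mul_pow_le_of_regroup {X : Scheme.{u}} {N N'' IE IG K : X.IdealSheafData} {ℓ w : ℕ}
    (hN : N = N'' * IG ^ w) (hNK : N * IE ^ ℓ ≤ K) : (N'' * IE ^ ℓ) * IG ^ w ≤ K := by
  calc (N'' * IE ^ ℓ) * IG ^ w = (N'' * IG ^ w) * IE ^ ℓ := by
        simp only [mul_comm, mul_left_comm, mul_assoc]
    _ = N * IE ^ ℓ := by rw [hN]
    _ ≤ K := hNK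

/-- **The regrouped monomial stays over the closed point**: if `N″` is cosupported over the closed point of `Spec S`
and the closed immersion `i : E ⟶ X` maps `E` to the closed point, then `N″ · 𝓘_E^ℓ` is cosupported over the closed
point. [cite: GortzWedhorn2020, Prop. 13.91 (1)] -/
theorem support_mul_ker_pow_over_closedPoint {S : Type u} [CommRing S] [IsLocalRing S] {E X : Scheme.{u}}
    (i : E ⟶ X) [IsClosedImmersion i] (g : X ⟶ Spec (.of S)) (N'' : X.IdealSheafData) (ℓ : ℕ)
    (hNpt : ∀ x : X, x ∈ (N''.support : Set X) → g.base x = IsLocalRing.closedPoint S)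
    (hEpt : ∀ e : E, g.base (i.base e) = IsLocalRing.closedPoint S) :
    ∀ x : X, x ∈ ((N'' * i.ker ^ ℓ).support : Set X) → g.base x = IsLocalRing.closedPoint S := by
  intro x hx
  rw [Scheme.IdealSheafData.support_mul, TopologicalSpace.Closeds.coe_sup] at hx
  rcases hx with hN | hE
  · exact hNpt x hN
  · rcases Nat.eq_zero_or_pos ℓ with hℓ | hℓ
    · subst hℓ
      rw [pow_zero, Scheme.IdealSheafData.one_eq_top, Scheme.IdealSheafData.support_top] at hE
      exact absurd hE id
    · rw [Scheme.IdealSheafData.support_pow _ _ hℓ.ne', Scheme.Hom.support_ker,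
        i.isClosedEmbedding.isClosed_range.closure_eq] at hE
      obtain ⟨e, rfl⟩ := hE
      exact hEpt e

/-! ## §2 The new exceptional divisor is a carrier -/

/-- **Carrier package of the exceptional divisor.** Let `X` be regular and locally Noetherian, `Ĉ` an ideal sheaf
with `V(Ĉ)` regular whose support lies over the closed point of `Spec S` along `g : X ⟶ Spec S`, and
`σ : X' ⟶ X` a blowing up along `Ĉ`. Then the exceptional divisor `G := V(Ĉ𝒪_{X'})`, with its inclusion
`j = subschemeι`, is a closed immersion whose ideal `ker j = Ĉ𝒪_{X'}` is an effective Cartier divisor (GW Def. 13.90),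
`G` is REGULAR (Liu Thm. 8.1.19 (b)), and `G` lies over the closed point along `σ ≫ g`.
[cite: Liu2002, Thm. 8.1.19 (b)] [cite: GortzWedhorn2020, Def. 13.90] -/
theorem exceptionalCarrier_package {S : Type u} [CommRing S] [IsLocalRing S] {X X' : Scheme.{u}}
    [IsLocallyNoetherian X] (hX : Scheme.IsRegular X) (g : X ⟶ Spec (.of S)) {Ĉ : X.IdealSheafData}
    (hĈ : Scheme.IsRegular Ĉ.subscheme)
    (hĈpt : ∀ x : X, x ∈ (Ĉ.support : Set X) → g.base x = IsLocalRing.closedPoint S)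
    {σ : X' ⟶ X} (hσ : IsBlowup σ Ĉ) :
    IsClosedImmersion (Ĉ.comap σ).subschemeι ∧
      (Ĉ.comap σ).subschemeι.ker = Ĉ.comap σ ∧
      IsEffectiveCartier (Ĉ.comap σ).subschemeι.ker ∧
      Scheme.IsRegular (Ĉ.comap σ).subscheme ∧
      ∀ y : (Ĉ.comap σ).subscheme,
        (σ ≫ g).base ((Ĉ.comap σ).subschemeι.base y) = IsLocalRing.closedPoint S := by
  refine ⟨inferInstance, Scheme.IdealSheafData.ker_subschemeι _, ?_, hσ.isRegular_subscheme_comap hX hĈ, ?_⟩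
  · rw [Scheme.IdealSheafData.ker_subschemeι]
    exact hσ.isEffectiveCartier
  · intro y
    have hy : (Ĉ.comap σ).subschemeι.base y ∈ ((Ĉ.comap σ).support : Set X') := by
      rw [← Scheme.IdealSheafData.range_subschemeι]
      exact ⟨y, rfl⟩
    rw [Scheme.IdealSheafData.support_comap] at hy
    simp only [Scheme.Hom.comp_base, TopCat.coe_comp, Function.comp_apply]
    exact hĈpt _ hy

/-- The pushed centre `Ĉ = C.map i` lies over the closed point when `E` does (`Supp Ĉ ⊆ i(E)`). [folklore] -/
theorem support_map_over_closedPoint {S : Type u} [CommRing S] [IsLocalRing S] {E X : Scheme.{u}}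
    (i : E ⟶ X) [IsClosedImmersion i] (g : X ⟶ Spec (.of S)) (C : E.IdealSheafData)
    (hEpt : ∀ e : E, g.base (i.base e) = IsLocalRing.closedPoint S) :
    ∀ x : X, x ∈ ((C.map i).support : Set X) → g.base x = IsLocalRing.closedPoint S := by
  intro x hx
  obtain ⟨e, rfl⟩ := support_map_subset_range i C hx
  exact hEpt e

/-! ## §3 After one D1^{ℓ,ν} step: the escaped depth-`(ℓ − ν)` state on the new carrier -/

/-- **Re-carrier after a weight-`ν` step.** In the situation of `DepthOne.dictionaryStep_mixed` (centre `Ĉ = C.map i`,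
`V(C) ⊆ E` regular, blowing up `σ : X' ⟶ X` of the regular locally Noetherian `X`, strict transform `i' : E' ⟶ X'` — a closed immersion
with effective Cartier ideal lying over the closed point, as that theorem concludes —, contact monomial `N` effective
Cartier over the closed point, and the concluded contact `(σ^*N · 𝓘_{exc}^{ℓ-ν}) · 𝓘_{E'}^ℓ ≤ K'`), the new
exceptional divisor `G = V(Ĉ𝒪_{X'})` is a REGULAR carrier over the closed point with effective Cartier ideal
`ker j = Ĉ𝒪_{X'}` (`j = subschemeι`), and the contact REGROUPS as `(σ^*N · 𝓘_{E'}^ℓ) · 𝓘_G^{ℓ-ν} ≤ K'` — monomial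
contact of exponent `ℓ − ν` with respect to `G`, the new monomial `σ^*N · 𝓘_{E'}^ℓ` being effective Cartier and
cosupported over the closed point. This is the host-side input of the escaped depth-`(ℓ − ν)` sub-problem on `G`
(KERNEL NOTE v1.6); the FORMAT `I𝒪_{X'} = M' · K'` is untouched. [cite: Liu2002, Thm. 8.1.19 (b)]
[cite: GortzWedhorn2020, Def. 13.90, Prop. 13.91 (1)] [cite: BierstoneGrigorievMilmanWlodarczyk2011, §3.2 Lemma 3.2.1] -/
theorem recarrier_of_dictionaryStep_mixed {S : Type u} [CommRing S] [IsLocalRing S] {ℓ ν : ℕ}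
    {E E' X X' : Scheme.{u}} (i : E ⟶ X) [IsClosedImmersion i] (i' : E' ⟶ X') [IsClosedImmersion i']
    (g : X ⟶ Spec (.of S)) [IsLocallyNoetherian X] (hX : Scheme.IsRegular X)
    (hEpt : ∀ e : E, g.base (i.base e) = IsLocalRing.closedPoint S)
    {C : E.IdealSheafData} (hC : Scheme.IsRegular C.subscheme)
    {σ : X' ⟶ X} (hσ : IsBlowup σ (C.map i)) (hkerE' : IsEffectiveCartier i'.ker)
    (hE'pt : ∀ e' : E', (σ ≫ g).base (i'.base e') = IsLocalRing.closedPoint S)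
    {N : X.IdealSheafData} {K' : X'.IdealSheafData} (hN : IsEffectiveCartier N)
    (hNpt : ∀ x : X, x ∈ (N.support : Set X) → g.base x = IsLocalRing.closedPoint S)
    (hcontact : (N.comap σ * (C.map i).comap σ ^ (ℓ - ν)) * i'.ker ^ ℓ ≤ K') :
    IsClosedImmersion ((C.map i).comap σ).subschemeι ∧
      ((C.map i).comap σ).subschemeι.ker = (C.map i).comap σ ∧
      IsEffectiveCartier ((C.map i).comap σ).subschemeι.ker ∧
      Scheme.IsRegular ((C.map i).comap σ).subscheme ∧
      (∀ y : ((C.map i).comap σ).subscheme,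
        (σ ≫ g).base (((C.map i).comap σ).subschemeι.base y) = IsLocalRing.closedPoint S) ∧
      IsEffectiveCartier (N.comap σ * i'.ker ^ ℓ) ∧
      (∀ x' : X', x' ∈ ((N.comap σ * i'.ker ^ ℓ).support : Set X') →
        (σ ≫ g).base x' = IsLocalRing.closedPoint S) ∧
      (N.comap σ * i'.ker ^ ℓ) * ((C.map i).comap σ).subschemeι.ker ^ (ℓ - ν) ≤ K' := by
  obtain ⟨hj, hker, hcart, hreg, hpt⟩ :=
    exceptionalCarrier_package hX g (isRegular_subscheme_map i C hC) (support_map_over_closedPoint i g C hEpt) hσ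
  -- the new monomial `σ^*N` lies over the closed point
  have hNσpt : ∀ x' : X', x' ∈ ((N.comap σ).support : Set X') →
      (σ ≫ g).base x' = IsLocalRing.closedPoint S := by
    intro x' hx'
    rw [Scheme.IdealSheafData.support_comap] at hx'
    simp only [Scheme.Hom.comp_base, TopCat.coe_comp, Function.comp_apply]
    exact hNpt _ hx'
  refine ⟨hj, hker, hcart, hreg, hpt, (hN.comap_of_isBlowup hσ).mul (hkerE'.pow ℓ),
    support_mul_ker_pow_over_closedPoint i' (σ ≫ g) (N.comap σ) ℓ hNσpt hE'pt, ?_⟩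
  rw [hker]
  exact mul_pow_mul_pow_le_of_regroup rfl hcontact

end DepthOne

end Summit.ResolutionOfSingularities.ResolutionOfSingularities.Theorems

end
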